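import Summits.NavierStokesRegularity.NavierStokesRegularity.Theorems.TypeICertificateLadderTargetDepletedEnstrophySlice
import HarnessLib

/-!
# Crux `Target` = `TypeICertificateLadder.NoTypeIBlowup` (stmt-NavierStokesRegularity-1217), line
# `depletion-ladder`: the PER-SLICE form of the depleted enstrophy inequality

`--supports stmt-NavierStokesRegularity-1217` (line `depletion-ladder`; per-solution form of stub S2
`stub_rung_of_depletion`, first file of three: slice → slab → stretching-number criterion).

Stub S2 (`Theorems.rung_of_stretchingDepletion`, p471856) consumes the line's depletion hypothesis
`StretchingDepletion κ` as a UNIVERSAL inequality over all bounded divergence-free fields. Its proof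
uses it only along the solution, one slice at a time. This file isolates the slice step with the
depletion replaced by an arbitrary PER-SLICE production bound: if at one time
`∫⟪ω, Dv ω⟫ ≤ L · ‖ω‖₂ · ‖∇ω‖₂` (`ω = curl v`, any real `L`; for `L = κ‖v‖_∞` this is the depletion
inequality at that slice, for `L = ‖v‖_∞` it is Cauchy–Schwarz), then the vorticity equation gives

  `∫ ⟪ω, curl ∂ₜu⟫ ≤ (L²/(4ν)) ‖ω‖₂²`   (`stretching_enstrophy_slice`),

i.e. `d/dt‖ω‖₂² ≤ (L²/(2ν))‖ω‖₂²`. The slab and decay steps (companion files) then show: a blow-up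
at `T` forces the STRETCHING NUMBER `S(t) := √((T−t)/ν) · ∫⟪ω, Du ω⟫/(‖ω‖₂‖∇ω‖₂)` to satisfy
`limsup_{t↑T} S(t) ≥ 1` — only the solution's own near-blow-up slices have to be depleted.

WHAT THIS IS NOT: a bookkeeping step (one-sided Young absorption); no depletion is proved. [folklore]

References: Lemarié-Rieusset 2016, §11.6 and Thm. 11.2; Robinson–Rodrigo–Sadowski 2016, Lemma 8.16.
-/

noncomputable section

open Set Filter Topology MeasureTheory
open scoped RealInnerProductSpace ENNReal NNReal Laplacian ContDiff
open Literature.Analysis.FluidPDE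

namespace Summit.NavierStokesRegularity.NavierStokesRegularity.Theorems.DepletionLadder

-- the problem directory repeats the summit name (`NavierStokesRegularity/NavierStokesRegularity`)
set_option linter.dupNamespace false

open Summit.NavierStokesRegularity.NavierStokesRegularity.Theorems.RungReynoldsOne
open Summit.NavierStokesRegularity.NavierStokesRegularity.Theorems.RungReynoldsOne.WeightedSlice

/-- **The enstrophy slice inequality under a per-slice production bound.** Let `v` be smooth and
divergence free with `ω = curl v`, `|v| ≤ M`, `‖Dv‖ ≤ B`, `Dv, D²v, D³v ∈ L²`, let `W` satisfy the
vorticity equation `curl W = νΔω − (v·∇)ω + (ω·∇)v`, and assume the one-sided production bound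
`∫⟪ω, Dv ω⟫ ≤ L · √(∫‖ω‖²) · √(∫|∇ω|²_F)` at this slice. Then `∫ ⟪ω, curl W⟫ ≤ (L²/(4ν)) ∫‖ω‖²`
(viscosity `−ν∫|∇ω|²_F`, transport `0`, Young `−νa² + Lza ≤ L²z²/(4ν)`). [folklore] -/
theorem stretching_enstrophy_slice {ν : ℝ} (hν : 0 < ν)
    {v W : EuclideanSpace ℝ (Fin 3) → EuclideanSpace ℝ (Fin 3)} (hv : ContDiff ℝ ∞ v)
    (hdiv : VectorCalculus.IsDivFree v)
    (hcurl : ∀ x, curl W x = ν • (Δ (curl v)) x - convect v (curl v) x + convect (curl v) v x)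
    {M B : ℝ} (hM : ∀ x, ‖v x‖ ≤ M) (hB : ∀ x, ‖fderiv ℝ v x‖ ≤ B)
    (h1 : ∫⁻ x, ‖iteratedFDeriv ℝ 1 v x‖ₑ ^ 2 < ⊤) (h2 : ∫⁻ x, ‖iteratedFDeriv ℝ 2 v x‖ₑ ^ 2 < ⊤)
    (h3 : ∫⁻ x, ‖iteratedFDeriv ℝ 3 v x‖ₑ ^ 2 < ⊤) {L : ℝ}
    (hJ : ∫ x, ⟪curl v x, fderiv ℝ v x (curl v x)⟫ ≤
      L * Real.sqrt (∫ x, ‖curl v x‖ ^ 2) * Real.sqrt (∫ x, frobeniusNormSq (fderiv ℝ (curl v) x))) :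
    ∫ x, ⟪curl v x, curl W x⟫ ≤ L ^ 2 / (4 * ν) * ∫ x, ‖curl v x‖ ^ 2 := by
  set e := EuclideanSpace.basisFun (Fin 3) ℝ with he
  have he1 : ∀ i, ‖e i‖ = 1 := fun i => by simp [he]
  -- smoothness of the vorticity
  have hDv : ContDiff ℝ ∞ (fderiv ℝ v) := (contDiff_infty_iff_fderiv.1 hv).2
  have hω : ContDiff ℝ ∞ (curl v) := by
    rw [curl_eq_curlCLM_comp]
    exact curlCLM.contDiff.comp hDv
  have hω2 : ContDiff ℝ 2 (curl v) := hω.of_le (by norm_cast)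
  have hω1 : ContDiff ℝ 1 (curl v) := hω.of_le (by norm_cast)
  have hv1 : ContDiff ℝ 1 v := hv.of_le (by norm_cast)
  have hv2 : ContDiff ℝ 2 v := hv.of_le (by norm_cast)
  have cv : Continuous v := hv.continuous
  have cω : Continuous (curl v) := hω.continuous
  -- `ω, ∂ᵢω, ∂ᵢ∂ᵢω ∈ L²`
  have l2ω : ∫⁻ x, ‖curl v x‖ₑ ^ 2 < ⊤ := by
    refine lintegral_enorm_sq_lt_top_of_norm_le_const_mul ‖curlCLM‖ (fun x => ?_) h1
    rw [← norm_iteratedFDeriv_fderiv, norm_iteratedFDeriv_zero]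
    exact norm_curl_le v x
  have l2dω : ∀ i, ∫⁻ x, ‖fderiv ℝ (curl v) x (e i)‖ₑ ^ 2 < ⊤ := fun i => by
    refine lintegral_enorm_sq_lt_top_of_norm_le_const_mul ‖curlCLM‖ (fun x => ?_) h2
    calc ‖fderiv ℝ (curl v) x (e i)‖ ≤ ‖fderiv ℝ (curl v) x‖ := by
          simpa [he1] using (fderiv ℝ (curl v) x).le_opNorm (e i)
      _ ≤ ‖curlCLM‖ * ‖iteratedFDeriv ℝ 2 v x‖ := norm_fderiv_curl_le hv2 x
  have l2ddω : ∀ i, ∫⁻ x, ‖fderiv ℝ (fun y => fderiv ℝ (curl v) y (e i)) x (e i)‖ₑ ^ 2 < ⊤ :=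
      fun i => by
    refine lintegral_enorm_sq_lt_top_of_norm_le_const_mul ‖curlCLM‖ (fun x => ?_) h3
    calc ‖fderiv ℝ (fun y => fderiv ℝ (curl v) y (e i)) x (e i)‖
        ≤ ‖iteratedFDeriv ℝ 2 (curl v) x‖ := norm_fderiv_fderiv_apply_basisFun_le hω2 x i
      _ ≤ ‖curlCLM‖ * ‖iteratedFDeriv ℝ 3 v x‖ := by
          rw [curl_eq_curlCLM_comp, curlCLM.iteratedFDeriv_comp_left (hDv.contDiffAt (x := x))
            (i := 2) (by norm_cast), ← norm_iteratedFDeriv_fderiv]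
          exact ContinuousLinearMap.norm_compContinuousMultilinearMap_le _ _
  -- the three terms
  obtain ⟨iLap, iFrob, hVisc⟩ := enstrophy_viscous hω2 l2ω l2dω l2ddω
  obtain ⟨iTr, hTr⟩ := enstrophy_transport hv1 hω2 hdiv hM hB l2ω l2dω
  have iStr : Integrable (fun x => ⟪curl v x, fderiv ℝ v x (curl v x)⟫) volume := by
    refine integrable_of_norm_le_const_mul_mul B
      (cω.inner ((hv1.continuous_fderiv one_ne_zero).clm_apply cω)) cω cω l2ω l2ω fun x => ?_
    calc ‖⟪curl v x, fderiv ℝ v x (curl v x)⟫‖ ≤ ‖curl v x‖ * ‖fderiv ℝ v x (curl v x)‖ :=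
          norm_inner_le_norm _ _
      _ ≤ ‖curl v x‖ * (B * ‖curl v x‖) :=
          mul_le_mul_of_nonneg_left ((fderiv ℝ v x).le_of_opNorm_le (hB x) _) (norm_nonneg _)
      _ = B * ‖curl v x‖ * ‖curl v x‖ := by ring
  set Z : ℝ := ∫ x, ‖curl v x‖ ^ 2 with hZdef
  set A : ℝ := ∫ x, frobeniusNormSq (fderiv ℝ (curl v) x) with hAdef
  set J : ℝ := ∫ x, ⟪curl v x, fderiv ℝ v x (curl v x)⟫ with hJdef
  have hZ0 : 0 ≤ Z := integral_nonneg fun x => sq_nonneg _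
  have hA0 : 0 ≤ A := integral_nonneg fun x => frobeniusNormSq_nonneg _
  -- pointwise decomposition of the integrand
  have hfun : (fun x => ⟪curl v x, curl W x⟫) = fun x =>
      ν * ⟪(Δ (curl v)) x, curl v x⟫ - ⟪curl v x, fderiv ℝ (curl v) x (v x)⟫ +
        ⟪curl v x, fderiv ℝ v x (curl v x)⟫ := by
    funext x
    have hc : ⟪curl v x, ν • (Δ (curl v)) x⟫ = ν * ⟪(Δ (curl v)) x, curl v x⟫ := by
      rw [real_inner_smul_right, real_inner_comm]
    rw [hcurl x]
    simp only [convect]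
    rw [inner_add_right, inner_sub_right, hc]
  have iAB : Integrable (fun x => ν * ⟪(Δ (curl v)) x, curl v x⟫ -
      ⟪curl v x, fderiv ℝ (curl v) x (v x)⟫) volume := (iLap.const_mul ν).sub iTr
  rw [hfun, integral_add iAB iStr, integral_sub (iLap.const_mul ν) iTr, integral_const_mul, hVisc,
    hTr, sub_zero]
  -- Young: `−νA + J ≤ −νA + L √Z √A ≤ L² Z/(4ν)`
  set z : ℝ := Real.sqrt Z with hzdef
  set a : ℝ := Real.sqrt A with hadef
  have hz2 : z ^ 2 = Z := Real.sq_sqrt hZ0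
  have ha2 : a ^ 2 = A := Real.sq_sqrt hA0
  have hν4 : 0 < 4 * ν := by positivity
  have key : ν * -A + L * z * a ≤ L ^ 2 / (4 * ν) * Z := by
    rw [← hz2, ← ha2, div_mul_eq_mul_div, le_div_iff₀ hν4]
    nlinarith [sq_nonneg (L * z - 2 * ν * a), hν]
  show ν * -A + J ≤ L ^ 2 / (4 * ν) * Z
  linarith [hJ]

end Summit.NavierStokesRegularity.NavierStokesRegularity.Theorems.DepletionLadder

end
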